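import Mathlib

/-!
# `MatrixDescartes` census — ALL 3×3 minors of the (2,K) Gram matrix factor through Plücker coordinates (rank-3 rows)

HONEST FRAMING.  Object-search cell `pub-symmetroid`, route crux `Theses.LacunarySymmetroid.MatrixDescartes`
(ledger item stmt-ValiantsHypothesis-18050).  Elementary exact algebra about the Gram matrix of the letters of a `2 × 2`
pencil in `(Sym₂(ℝ), det) ≅ ℝ^{1,2}` — the RANK-3 structure that the door-A V = 20 programme needs beyond Newton rows
(R1076: «the class where only rank-3 rows can decide»; engine-5 g14's rank-3 instrument).  With `ĝ_ij = 2B(S_i,S_j) =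
a_i c_j + c_i a_j − 2 b_i b_j` (`a = S·0 0`, `b = S·0 1`, `c = S·1 1`; `ĝ_ii = 2 det S_i`), the `K × K` matrix `Ĝ` is
`N M Nᵀ` with `N` the `K × 3` matrix of letter entries and `M = [[0,0,1],[0,−2,0],[1,0,0]]`, `det M = 2`.  Hence for ANY
two index triples `I, J : Fin 3 → Fin K` (not only principal ones):
`det Ĝ[I,J] = 2 · det N_I · det N_J` (`det_gramHat_minor_three`) — the 3×3 minors are products of PLÜCKER COORDINATES
`p_I = det N_I`; consequently `det Ĝ[I,J]² = det Ĝ[I,I] · det Ĝ[J,J]` (`gramHat_minor_three_sq`) and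
`det Ĝ[I,J] · det Ĝ[J,L] · det Ĝ[L,I] ≥ 0` (`gramHat_minor_three_cycle_nonneg`) — exact rank-3 rows valid for every
real `2 × 2` pencil (the tree's `gram_three_eq_sq` is the principal case `I = J`, `gram_det_four_eq_zero` the rank
statement).  No symmetry hypothesis is needed (only `S·0 1` enters).  Nothing here bounds any root count; nothing on
`DoorA26`/`DoorA34` (OPEN), the crux, or `VP ≠ VNP`.

[folklore] Cauchy–Binet for a product of square blocks.
-/

-- `Summit.ValiantsHypothesis.ValiantsHypothesis.…` repeats a component by the D-0017 layout
-- (single-conjunct summit), which the `dupNamespace` linter flags; the name is mandated.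
set_option linter.dupNamespace false

namespace Summit.ValiantsHypothesis.ValiantsHypothesis.Theorems.LacunarySymmetroidMatrixDescartes.Census

open Matrix
open scoped BigOperators

/-- The `3 × 3` submatrix on rows `I`, columns `J` of the polarised-determinant Gram matrix
`ĝ_ij = S i 0 0 · S j 1 1 + S i 1 1 · S j 0 0 − 2 · S i 0 1 · S j 0 1` is `N_I · M · N_Jᵀ` with `N` the matrix of letter
entries `(a, b, c)` and `M = !![0,0,1; 0,−2,0; 1,0,0]`. [folklore] -/
theorem gramHat_submatrix_eq {K : ℕ} (S : Fin K → Matrix (Fin 2) (Fin 2) ℝ) (I J : Fin 3 → Fin K) :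
    (Matrix.of fun i j : Fin K =>
        S i 0 0 * S j 1 1 + S i 1 1 * S j 0 0 - 2 * (S i 0 1 * S j 0 1)).submatrix I J
      = (Matrix.of fun (r : Fin 3) (k : Fin 3) => ![S (I r) 0 0, S (I r) 0 1, S (I r) 1 1] k)
        * !![(0 : ℝ), 0, 1; 0, -2, 0; 1, 0, 0]
        * (Matrix.of fun (r : Fin 3) (k : Fin 3) => ![S (J r) 0 0, S (J r) 0 1, S (J r) 1 1] k)ᵀ := by
  ext r s
  simp only [Matrix.submatrix_apply, Matrix.of_apply, Matrix.mul_apply, Matrix.transpose_apply, Fin.sum_univ_three]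
  simp only [Matrix.cons_val_zero, Matrix.cons_val_one, Matrix.cons_val, Matrix.cons_val',
    Matrix.empty_val', Matrix.cons_val_fin_one]
  ring

/-- **Every 3×3 minor of the Gram matrix is a product of Plücker coordinates.**  For ANY index triples
`I, J : Fin 3 → Fin K`: `det Ĝ[I,J] = 2 · det N_I · det N_J`, `N_I` the `3 × 3` matrix of the entries `(a, b, c)` of the
letters `S (I 0), S (I 1), S (I 2)`.  (`I = J`: the tree's `gram_three_eq_sq`, `det Ĝ[I,I] = 2 (det N_I)² ≥ 0`.) [folklore] -/
theorem det_gramHat_minor_three {K : ℕ} (S : Fin K → Matrix (Fin 2) (Fin 2) ℝ) (I J : Fin 3 → Fin K) :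
    ((Matrix.of fun i j : Fin K =>
        S i 0 0 * S j 1 1 + S i 1 1 * S j 0 0 - 2 * (S i 0 1 * S j 0 1)).submatrix I J).det
      = 2 * (Matrix.of fun (r : Fin 3) (k : Fin 3) => ![S (I r) 0 0, S (I r) 0 1, S (I r) 1 1] k).det
          * (Matrix.of fun (r : Fin 3) (k : Fin 3) => ![S (J r) 0 0, S (J r) 0 1, S (J r) 1 1] k).det := by
  rw [gramHat_submatrix_eq, Matrix.det_mul, Matrix.det_mul, Matrix.det_transpose]
  have hM : (!![(0 : ℝ), 0, 1; 0, -2, 0; 1, 0, 0]).det = 2 := by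
    rw [Matrix.det_fin_three]
    simp
  rw [hM]
  ring

/-- **Rank-3 row (square form).**  `det Ĝ[I,J]² = det Ĝ[I,I] · det Ĝ[J,J]` for any index triples. [folklore] -/
theorem gramHat_minor_three_sq {K : ℕ} (S : Fin K → Matrix (Fin 2) (Fin 2) ℝ) (I J : Fin 3 → Fin K) :
    ((Matrix.of fun i j : Fin K =>
        S i 0 0 * S j 1 1 + S i 1 1 * S j 0 0 - 2 * (S i 0 1 * S j 0 1)).submatrix I J).det ^ 2
      = ((Matrix.of fun i j : Fin K =>
          S i 0 0 * S j 1 1 + S i 1 1 * S j 0 0 - 2 * (S i 0 1 * S j 0 1)).submatrix I I).det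
        * ((Matrix.of fun i j : Fin K =>
          S i 0 0 * S j 1 1 + S i 1 1 * S j 0 0 - 2 * (S i 0 1 * S j 0 1)).submatrix J J).det := by
  rw [det_gramHat_minor_three, det_gramHat_minor_three, det_gramHat_minor_three]
  ring

/-- **Rank-3 row (cycle form).**  For any three index triples `I, J, L`:
`det Ĝ[I,J] · det Ĝ[J,L] · det Ĝ[L,I] = 8 (det N_I · det N_J · det N_L)² ≥ 0` — the forced signs of 3×3 minors of a
hypothetical pencil's Gram matrix must be multiplicatively consistent. [folklore] -/
theorem gramHat_minor_three_cycle_nonneg {K : ℕ} (S : Fin K → Matrix (Fin 2) (Fin 2) ℝ) (I J L : Fin 3 → Fin K) :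
    0 ≤ ((Matrix.of fun i j : Fin K =>
          S i 0 0 * S j 1 1 + S i 1 1 * S j 0 0 - 2 * (S i 0 1 * S j 0 1)).submatrix I J).det
        * ((Matrix.of fun i j : Fin K =>
          S i 0 0 * S j 1 1 + S i 1 1 * S j 0 0 - 2 * (S i 0 1 * S j 0 1)).submatrix J L).det
        * ((Matrix.of fun i j : Fin K =>
          S i 0 0 * S j 1 1 + S i 1 1 * S j 0 0 - 2 * (S i 0 1 * S j 0 1)).submatrix L I).det := by
  rw [det_gramHat_minor_three, det_gramHat_minor_three, det_gramHat_minor_three]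
  set x := (Matrix.of fun (r : Fin 3) (k : Fin 3) => ![S (I r) 0 0, S (I r) 0 1, S (I r) 1 1] k).det
  set y := (Matrix.of fun (r : Fin 3) (k : Fin 3) => ![S (J r) 0 0, S (J r) 0 1, S (J r) 1 1] k).det
  set z := (Matrix.of fun (r : Fin 3) (k : Fin 3) => ![S (L r) 0 0, S (L r) 0 1, S (L r) 1 1] k).det
  have : 2 * x * y * (2 * y * z) * (2 * z * x) = 8 * (x * y * z) ^ 2 := by ring
  rw [this]
  positivity

end Summit.ValiantsHypothesis.ValiantsHypothesis.Theorems.LacunarySymmetroidMatrixDescartes.Census
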